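import Summits.BirchSwinnertonDyer.BirchSwinnertonDyer.Theorems.PrintCf2RamifiedOffTYZLayerOneSilence
import Summits.BirchSwinnertonDyer.BirchSwinnertonDyer.Theorems.PrintCf2RamifiedOffTYZSelmerRankOneMoverSeven
import HarnessLib

/-!
# Crux `PrintCf2.RamifiedOffTYZOfFacts` (stmt-BirchSwinnertonDyer-20509), line `offtyz-v7`, LEAD cycle 11 (cruxlead-20509 g10), part 4b:
# LAYER-1 SILENCE FOR ALL ODD `n ≡ 5, 7 (mod 8)` with `s(n) ≥ 2`

THEOREMS ONLY (no `def`, no named fact, no `sorry`), `--supports stmt-BirchSwinnertonDyer-20509`.  Sequel of `…LayerOneSilence` (p722439, `n ≡ 5`):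
the same statement for every ODD square-free `n ≡ 5` or `7 (mod 8)`, through the LEAD g8 criterion for both odd residues
(`MoverAssembly.sqMover_iff_sum_blocks_odd`, `…MoverSumBlocksOdd`) and (★) for both odd residues (`QFormForest.qFormIdentityOmega_odd`,
`…QFormIdentitySeven`).  Hypotheses = those displays + Thm 1.1 + Monsky's formula (tree theorem); nothing is asserted; BSD is not proved by any
of this; no class is closed.

**`galPt_sq_genusPoint_eq_of_card_selmer_odd`**: `n = p₁⋯p_k ≡ 5` or `7 (mod 8)`, `#Sel₂(E_n/ℚ) = 2^{2+s}` with `s ≥ 2` ⟹ `g²·P(n) = P(n)` for every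
`g ∈ Gal(ℍ′_n/ℚ)`.  In particular on the whole ODD jump-one class (`#Sel₂ = 2⁵`; the sectors R1/R2 and type T of
`…LevelTwoTwoPrimes` / `…LevelTwoTwoStep`, and every odd k) no square moves the genus point: the cycles 5–10 mover engine and g4's door
«mover ⟹ `4 ∤ 𝓛(n)`» are closed there (`…_thirtytwo_odd`).

References: [cite: TianYuanZhang2017, §3.1 (p0011 L53–L73), Prop. 3.2 (1), Thm. 3.6 (1), (3), proof of Lemma 3.21 (p0020 L27–L63), Thm. 1.1];
[cite: HeathBrown1994SelmerCongruentII, Appendix (Monsky), typescript p. 39 L10–L41]; [cite: Smith2016CongruentDensity, Thm. 1.2, §2]; tree: p722439,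
g7/g8 `…MoverSumBlocksOdd`, `…QFormIdentitySeven`.
-/

noncomputable section

open scoped Classical NumberField

open WeierstrassCurve WeierstrassCurve.Affine Finset Matrix Literature.NumberTheory.EllipticCurves
  Literature.NumberTheory.EllipticCurves.TianYuanZhang2017
  Literature.NumberTheory.EllipticCurves.TianYuanZhang2017.W2
  Literature.NumberTheory.EllipticCurves.HeathBrown1994
  Literature.NumberTheory.EllipticCurves.Smith2016
  Literature.NumberTheory.QuadraticFields.RingClass
  Literature.NumberTheory.QuadraticFields
  Summit.BirchSwinnertonDyer.PrintCf2.QForm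
  Summit.BirchSwinnertonDyer.PrintCf2.QFormForest
  Summit.BirchSwinnertonDyer.PrintCf2.MoverAssembly
  Summit.BirchSwinnertonDyer.PrintCf2.LayerOneSilence

set_option autoImplicit false

namespace Summit.BirchSwinnertonDyer.PrintCf2.LayerOneSilenceOdd

variable {k : ℕ} (p : Fin k → ℕ) (hp : ∀ i, (p i).Prime) (hodd : ∀ i, Odd (p i)) (hinj : Function.Injective p)
variable {n : ℕ} (D : GenusPointData n)

include hp hodd hinj in
/-- **`κ = 0` ⟹ the block sum vanishes identically**, for `∏ pᵢ ≡ 5` OR `7 (mod 8)` ((★) for both odd residues).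
[cite: HeathBrown1994SelmerCongruentII, Appendix (Monsky), typescript p. 39 L27–L41] [cite: Smith2016CongruentDensity, §2] -/
theorem sum_blocks_eq_zero_of_kappa_eq_zero_odd (h57 : (∏ i, p i) % 8 = 5 ∨ (∏ i, p i) % 8 = 7) (hκ : kappa p = 0)
    (xim : ZMod 2) (x : Fin k → ZMod 2) :
    (∑ S : Finset (Fin k), (if (∏ l ∈ S, p l) % 8 = 5 then
        coblockWeight p S * (1 + (xim + ∑ l ∈ S, x l)) * ∑ l ∈ S, blockRho p S l * x l else 0)) = 0 := by
  obtain ⟨hdiag, hoff⟩ := qFormIdentityOmega_odd k p hp hodd hinj h57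
  have hA : ∀ i, kappaA p i = 0 := fun i => by rw [kappaA, hκ]; rfl
  have hB : ∀ i, kappaB p i = 0 := fun i => by rw [kappaB, hκ]; rfl
  have hdiag0 : ∀ j, Omega p j j = 0 := fun j => by rw [hdiag j, hB j]
  have hsymm : ∀ a b, Omega p a b + Omega p b a = 0 := by
    intro a b
    by_cases hab : a = b
    · subst hab; rw [hdiag0]; decide
    · rw [hoff a b hab, hA, hB, hA, hB]; decide
  rw [sum_blocks_eq_omega_form p xim x]
  have h1 : (∑ j, Omega p j j * x j) = 0 := Finset.sum_eq_zero fun j _ => by rw [hdiag0 j, zero_mul]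
  have h2 : (∑ a, ∑ b, Omega p b a * (x a * x b)) = 0 := by
    rw [← Finset.sum_product' (f := fun a b => Omega p b a * (x a * x b)), Finset.univ_product_univ]
    refine Finset.sum_ninvolution (fun ab => (ab.2, ab.1)) (fun ab => ?_) (fun ab hne => ?_) (fun ab => mem_univ _)
      (fun ab => rfl)
    · have e : Omega p ab.2 ab.1 * (x ab.1 * x ab.2) + Omega p ab.1 ab.2 * (x ab.2 * x ab.1) =
          (Omega p ab.2 ab.1 + Omega p ab.1 ab.2) * (x ab.1 * x ab.2) := by ring
      rw [e, hsymm, zero_mul]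
    · intro h
      apply hne
      have h12 : ab.1 = ab.2 := by simpa using congrArg Prod.snd h
      rw [← h12, hdiag0, zero_mul]
  rw [h1, h2, mul_zero, add_zero]

include hp hodd hinj in
/-- **LAYER-1 SILENCE FOR ODD `n ≡ 5, 7 (mod 8)`.**  `n = p₁⋯p_k` square-free, `n ≡ 5` or `7 (mod 8)`; the printed recursion and sign choices;
the CM-point layer, conductor-2 ring class dictionary and Frobenius clause on every block; Thm 1.1; `#Sel₂(E_n/ℚ) = 2^{2+s}`, `s ≥ 2`.  Then
**`g²·P(n) = P(n)` for every `g ∈ Gal(ℍ′_n/ℚ)`.**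
[cite: TianYuanZhang2017, §3.1 (p0011 L53–L73), Prop. 3.2 (1), Thm. 3.6 (1), (3), proof of Lemma 3.21 (p0020 L27–L63), Thm. 1.1]
[cite: HeathBrown1994SelmerCongruentII, Appendix (Monsky), typescript p. 39 L10–L41] [cite: Smith2016CongruentDensity, Thm. 1.2] -/
theorem galPt_sq_genusPoint_eq_of_card_selmer_odd (hn : n = ∏ i, p i) (h57 : n % 8 = 5 ∨ n % 8 = 7) (hrec : D.recursion)
    (hLs : D.scriptLSpec)
    (z : ℕ → APoint D.H) (Φ : ℕ → Finset (D.H ≃ₐ[ℚ] D.H)) (ΓH ΓH' : ℕ → Subgroup (D.H ≃ₐ[ℚ] D.H))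
    (σ : ℕ → (D.H ≃ₐ[ℚ] D.H)) (c : D.H ≃ₐ[ℚ] D.H) (ρ : (d : ℕ) → (D.galK d →* RingClassGroup (GenusField d) 2))
    (hc : D.ConjSpec c)
    (hblock : ∀ d ∈ n.divisors, ((d % 8 = 5 ∨ d % 8 = 6) → D.CMBlockSpec d (z d) (Φ d) (ΓH d) (ΓH' d) (σ d) c) ∧
      (d % 8 = 7 → D.SevenBlockSpec d))
    (hring : ∀ d ∈ n.divisors, d % 8 = 5 → D.RingClassTwoBlockSpec d (ΓH d) (ΓH' d) (ρ d))
    (hFrob : ∀ d ∈ n.divisors, d % 8 = 5 → ∀ q : ℕ, q.Prime → q ∣ d → ∃ φ : D.H ≃ₐ[ℚ] D.H,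
      φ (D.sqrtNeg d) = D.sqrtNeg d ∧ φ * φ ∈ ΓH' d ∧ φ D.im = (jacobiSym (-1) q) • D.im ∧
        ∀ r : ℕ, r.Prime → r ∣ n → r ≠ q → φ (D.sqrtNeg r) = (jacobiSym (-(r : ℤ)) q) • D.sqrtNeg r)
    (h11 : thm11_parity_of_scriptL) {s : ℕ} (hs : 2 ≤ s)
    (hsel : Nat.card ((congruentNumberCurve n).selmerGroup 2) = 2 ^ (2 + s)) (g : D.H ≃ₐ[ℚ] D.H) :
    D.galPt (g * g) (D.P n) = D.P n := by
  have hprod : (∏ i, p i) % 8 = 5 ∨ (∏ i, p i) % 8 = 7 := by rw [← hn]; exact h57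
  have hsel' : Nat.card ((congruentNumberCurve (∏ i, p i)).selmerGroup 2) = 2 ^ (2 + s) := by rw [← hn]; exact hsel
  have hκ : kappa p = 0 := kappa_eq_zero_of_card_selmer p hp hodd hinj hs hsel'
  have key : ∀ (xim : ZMod 2) (x : Fin k → ZMod 2),
      (∑ S : Finset (Fin k), (if (∏ l ∈ S, p l) % 8 = 5 then
        coblockWeight p S * (1 + (xim + ∑ l ∈ S, x l)) * ∑ l ∈ S, blockRho p S l * x l else 0)) = 0 :=
    sum_blocks_eq_zero_of_kappa_eq_zero_odd p hp hodd hinj hprod hκ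
  by_contra hne
  have h1 := (sqMover_iff_sum_blocks_odd p hp hodd hinj D hn h57 hrec hLs z Φ ΓH ΓH' σ c ρ hc hblock hring hFrob h11 g).mp hne
  have h0 := key (if g D.im = D.im then (0 : ZMod 2) else 1)
    (fun i => if g (D.im * D.sqrtNeg (p i)) = D.im * D.sqrtNeg (p i) then (0 : ZMod 2) else 1)
  beta_reduce at h0
  rw [h0] at h1
  exact zero_ne_one h1

include hp hodd hinj in
/-- **Layer-1 silence on the whole ODD jump-one class** (`#Sel₂(E_n) = 2⁵`, `n ≡ 5` or `7 (mod 8)`; the class of C⁺ = item 23431 restricted to odd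
`n`): every square of `Gal(ℍ′_n/ℚ)` fixes `P(n)`.
[cite: TianYuanZhang2017, §3.1 (p0011 L53–L73), Thm. 3.6 (1), (3), proof of Lemma 3.21, Thm. 1.1] [cite: HeathBrown1994SelmerCongruentII, Appendix (Monsky), typescript p. 39 L10–L41] -/
theorem galPt_sq_genusPoint_eq_of_card_selmer_thirtytwo_odd (hn : n = ∏ i, p i) (h57 : n % 8 = 5 ∨ n % 8 = 7)
    (hrec : D.recursion) (hLs : D.scriptLSpec)
    (z : ℕ → APoint D.H) (Φ : ℕ → Finset (D.H ≃ₐ[ℚ] D.H)) (ΓH ΓH' : ℕ → Subgroup (D.H ≃ₐ[ℚ] D.H))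
    (σ : ℕ → (D.H ≃ₐ[ℚ] D.H)) (c : D.H ≃ₐ[ℚ] D.H) (ρ : (d : ℕ) → (D.galK d →* RingClassGroup (GenusField d) 2))
    (hc : D.ConjSpec c)
    (hblock : ∀ d ∈ n.divisors, ((d % 8 = 5 ∨ d % 8 = 6) → D.CMBlockSpec d (z d) (Φ d) (ΓH d) (ΓH' d) (σ d) c) ∧
      (d % 8 = 7 → D.SevenBlockSpec d))
    (hring : ∀ d ∈ n.divisors, d % 8 = 5 → D.RingClassTwoBlockSpec d (ΓH d) (ΓH' d) (ρ d))
    (hFrob : ∀ d ∈ n.divisors, d % 8 = 5 → ∀ q : ℕ, q.Prime → q ∣ d → ∃ φ : D.H ≃ₐ[ℚ] D.H,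
      φ (D.sqrtNeg d) = D.sqrtNeg d ∧ φ * φ ∈ ΓH' d ∧ φ D.im = (jacobiSym (-1) q) • D.im ∧
        ∀ r : ℕ, r.Prime → r ∣ n → r ≠ q → φ (D.sqrtNeg r) = (jacobiSym (-(r : ℤ)) q) • D.sqrtNeg r)
    (h11 : thm11_parity_of_scriptL)
    (hsel : Nat.card ((congruentNumberCurve n).selmerGroup 2) = 2 ^ 5) (g : D.H ≃ₐ[ℚ] D.H) :
    D.galPt (g * g) (D.P n) = D.P n :=
  galPt_sq_genusPoint_eq_of_card_selmer_odd p hp hodd hinj D hn h57 hrec hLs z Φ ΓH ΓH' σ c ρ hc hblock hring hFrob h11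
    (s := 3) (by norm_num) (by rw [hsel]) g

end Summit.BirchSwinnertonDyer.PrintCf2.LayerOneSilenceOdd

end
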